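import Summits.CriticalPhenomena.PercolationContinuityZ3.Theorems.PercNearOneGluingNoHeavyQuantFarSunHairCert
import Summits.CriticalPhenomena.PercolationContinuityZ3.Theorems.PercNearOneGluingNoHeavyQuantCountDP
import Mathlib.Data.Nat.Nth
import HarnessLib

/-!
# FAR beyond trees: the HAIR-COUNT BRIDGE — hair-only tails `hairV` as Poisson-binomial tails `PB[·, ·]`, with the product form for a
# coverage set and its gap

builds on p205010 (kernel theorem, internal audit signed; external expert review pending)

Support file (`--supports stmt-CriticalPhenomena-4575`), seat `prim-cert-1` (gen 37); memo `prim-cert-1/FROM-prim-cert-1-g37-SURPLUS-FAR.md` §4 B(1).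
The hair-only certificates of `HairyCycle.sunFAR_of_hairCert` (p367779) are inequalities for `hairV K h j C = Σ_Q hairW K h Q·𝟙[j+1 ≤ #(Q ∩ C)]`;
the analytic tools (`Quant.CountDP.deficit_far_two`, `Quant.CountDP.surplus_far_two`, the sojourn lemma) speak the recursion `PB[p, m] b` of
`…QuantCountDP`.  This file is the dictionary, by induction on the number of hairs `K` through ONE identity (`HairyCycle.sum_hairW_succ`):

* `HairyCycle.sum_hairW_succ` — `Σ_{Q ⊆ [0,K]} hairW (K+1) h Q·Φ(Q) = Σ_{Q ⊆ [0,K)} hairW K h Q·[(1 − h K)Φ(Q) + h K·Φ(Q ∪ {K})]`.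
* `HairyCycle.sum_hairW_count_eq_PB` — **the bridge**: for a finite index set `C`,
  `Σ_Q hairW K h Q·f(#(Q ∩ C)) = Σ_{b ≤ n} PB[h ∘ nth_C, n] b·f(b)` with `n = Nat.count (· ∈ C) K` and `nth_C = Nat.nth (· ∈ C)` (the members of `C`
  in increasing order): the number of open hairs in `C` is the success count of the trials `h(c₀), h(c₁), …`.
* `HairyCycle.sum_nth_eq_sum_filter` — `Σ_{i<n} h(nth_C i) = Σ_{k<K, k∈C} h k` (the mean of those trials is `E(C)`; `n = #(C ∩ [0,K))` is
  `Nat.count_eq_card_filter_range`).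
* `HairyCycle.sum_hairW_count_mul_count` — **product form**: for DISJOINT `C`, `D`,
  `Σ_Q hairW·f(#(Q∩C))·g(#(Q∩D)) = (Σ_Q hairW·f(#(Q∩C)))·(Σ_Q hairW·g(#(Q∩D)))` (the two counts are independent).
* `HairyCycle.hairV_eq_one_sub_cdf` — `hairV K h j C = 1 − Σ_{i<j+1} PB[h ∘ nth_C, n] i`.
* `HairyCycle.sum_hairW_pos_count_le` — `P(some hair of D open) = Σ_Q hairW·𝟙[1 ≤ #(Q∩D)] ≤ Σ_{k<K, k∈D} h k` (union bound), and `≤ 1`.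
* `HairyCycle.hairV_univ_sub_hairV_le` — **the gap bound of LEMMA L**: for finite `C` with gap `D = [0,K) ∖ C`,
  `hairV K h j [0,K) − hairV K h j C ≤ (1 − hairV K h j C)·min(1, E(D))` (`T ≥ j+1 > N_C` forces an open hair in the gap, independently of `N_C`).
Pure finite algebra (no measure theory); no definitions, no sorries, standard axioms.  Elementary [this work].
-/

noncomputable section

namespace Summit.CriticalPhenomena.PercolationContinuityZ3.Theorems.HairyCycle

open Finset
open scoped Classical

/-- `PB[p, m] b` = probability that exactly `b` of the first `m` independent trials succeed (the recursion of `…QuantCountDP.lean`). -/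
local notation3 "PB[" p ", " m "]" =>
  (Nat.rec (motive := fun _ => ℕ → ℝ) (fun b => if b = 0 then (1 : ℝ) else 0)
    (fun n f b => (p : ℕ → ℝ) n * (if b = 0 then (0 : ℝ) else f (b - 1)) + (1 - (p : ℕ → ℝ) n) * f b) (m : ℕ))

variable {K : ℕ}

/-! ## Adding one hair -/

/-- **One more hair.**  `Σ_{Q ⊆ range (K+1)} hairW (K+1) h Q · Φ Q = Σ_{Q ⊆ range K} hairW K h Q · ((1 − h K)·Φ Q + h K·Φ (insert K Q))`
(every real `h`, every `Φ`). [this work] -/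
theorem sum_hairW_succ (K : ℕ) (h : ℕ → ℝ) (Φ : Finset ℕ → ℝ) :
    ∑ Q ∈ (range (K + 1)).powerset, hairW (K + 1) h Q * Φ Q =
      ∑ Q ∈ (range K).powerset, hairW K h Q * ((1 - h K) * Φ Q + h K * Φ (insert K Q)) := by
  have hK : K ∉ range K := Finset.notMem_range_self
  rw [Finset.range_add_one, Finset.sum_powerset_insert hK]
  have h1 : ∀ Q ∈ (range K).powerset, hairW (K + 1) h Q = hairW K h Q * (1 - h K) := by
    intro Q hQ
    rw [Finset.mem_powerset] at hQ
    have hKQ : K ∉ Q := fun hm => hK (hQ hm)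
    unfold hairW
    rw [Finset.prod_range_succ, if_neg hKQ]
  have h2 : ∀ Q ∈ (range K).powerset, hairW (K + 1) h (insert K Q) = hairW K h Q * h K := by
    intro Q hQ
    rw [Finset.mem_powerset] at hQ
    unfold hairW
    rw [Finset.prod_range_succ, if_pos (Finset.mem_insert_self K Q)]
    congr 1
    refine Finset.prod_congr rfl fun k hk => ?_
    have hkK : k ≠ K := fun e => hK (e ▸ hk)
    simp only [Finset.mem_insert, hkK, false_or]
  rw [← Finset.sum_add_distrib]
  refine Finset.sum_congr rfl fun Q hQ => ?_
  rw [h1 Q hQ, h2 Q hQ]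
  ring

/-! ## The bridge to `PB` -/

/-- **One more hair, for the count in `C`**: with `M_K(f) = Σ_{Q ⊆ range K} hairW K h Q · f(#(Q ∩ C))`,
`M_{K+1}(f) = (1 − h K)·M_K(f) + h K·M_K(f(· + 1))` if `K ∈ C`, and `M_{K+1}(f) = M_K(f)` if `K ∉ C`. [this work] -/
theorem sum_hairW_count_succ (K : ℕ) (h : ℕ → ℝ) (C : Finset ℕ) (f : ℕ → ℝ) :
    ∑ Q ∈ (range (K + 1)).powerset, hairW (K + 1) h Q * f (Q ∩ C).card =
      if K ∈ C then
        (1 - h K) * ∑ Q ∈ (range K).powerset, hairW K h Q * f (Q ∩ C).card +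
          h K * ∑ Q ∈ (range K).powerset, hairW K h Q * f ((Q ∩ C).card + 1)
      else ∑ Q ∈ (range K).powerset, hairW K h Q * f (Q ∩ C).card := by
  rw [sum_hairW_succ K h (fun Q => f (Q ∩ C).card)]
  split_ifs with hKC
  · rw [Finset.mul_sum, Finset.mul_sum, ← Finset.sum_add_distrib]
    refine Finset.sum_congr rfl fun Q hQ => ?_
    rw [Finset.mem_powerset] at hQ
    have hKQ : K ∉ Q ∩ C := fun hm => Finset.notMem_range_self (hQ (Finset.mem_inter.1 hm).1)
    have e : (insert K Q ∩ C).card = (Q ∩ C).card + 1 := by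
      rw [Finset.insert_inter_of_mem hKC, Finset.card_insert_of_notMem hKQ]
    rw [e]
    ring
  · refine Finset.sum_congr rfl fun Q hQ => ?_
    have e : insert K Q ∩ C = Q ∩ C := Finset.insert_inter_of_notMem hKC
    rw [e]
    ring

/-- **THE BRIDGE.**  For every finite `C`, real `h` and test function `f`:
`Σ_{Q ⊆ range K} hairW K h Q · f(#(Q ∩ C)) = Σ_{b ≤ n} PB[h ∘ Nat.nth (· ∈ C), n] b · f b`, `n = Nat.count (· ∈ C) K`
— the number of open hairs with index in `C` is the success count of the independent trials `h(c₀), h(c₁), …` (`c_i` the members of `C`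
in increasing order). [this work] -/
theorem sum_hairW_count_eq_PB (h : ℕ → ℝ) (C : Finset ℕ) : ∀ K : ℕ, ∀ f : ℕ → ℝ,
    ∑ Q ∈ (range K).powerset, hairW K h Q * f (Q ∩ C).card =
      ∑ b ∈ range (Nat.count (· ∈ C) K + 1), PB[(fun i => h (Nat.nth (· ∈ C) i)), Nat.count (· ∈ C) K] b * f b := by
  intro K
  induction K with
  | zero =>
    intro f
    simp [hairW]
  | succ K ih =>
    intro f
    rw [sum_hairW_count_succ K h C f, Nat.count_succ]
    by_cases hKC : K ∈ C
    · rw [if_pos hKC, if_pos hKC, ih f, ih (fun b => f (b + 1))]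
      -- the PB recursion at the new trial `nth (count K) = K`
      set n := Nat.count (· ∈ C) K with hn
      set q : ℕ → ℝ := fun i => h (Nat.nth (· ∈ C) i) with hq
      have hqn : q n = h K := by rw [hq]; simp only; rw [hn, Nat.nth_count hKC]
      -- expand `Σ_{b ≤ n+1} PB[q, n+1] b f b`
      have hsplit : ∑ b ∈ range (n + 1 + 1), PB[q, n + 1] b * f b =
          q n * ∑ b ∈ range (n + 1), PB[q, n] b * f (b + 1) + (1 - q n) * ∑ b ∈ range (n + 1), PB[q, n] b * f b := by
        have e1 : ∑ b ∈ range (n + 1 + 1), PB[q, n + 1] b * f b =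
            ∑ b ∈ range (n + 1 + 1), ((q n * (if b = 0 then (0 : ℝ) else PB[q, n] (b - 1))) * f b +
              ((1 - q n) * PB[q, n] b) * f b) :=
          Finset.sum_congr rfl fun b _ => by rw [Quant.CountDP.PB_succ]; ring
        rw [e1, Finset.sum_add_distrib]
        congr 1
        · rw [Finset.sum_range_succ', Finset.mul_sum]
          simp only [if_true, mul_zero, zero_mul, add_zero, Nat.add_one_ne_zero, if_false, Nat.add_sub_cancel]
          refine Finset.sum_congr rfl fun b _ => ?_
          ring
        · rw [Finset.sum_range_succ, Quant.CountDP.PB_eq_zero_of_lt q n (n + 1) (by omega), mul_zero, zero_mul, add_zero,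
            Finset.mul_sum]
          refine Finset.sum_congr rfl fun b _ => ?_
          ring
      rw [hsplit, hqn]
      ring
    · rw [if_neg hKC, if_neg hKC, Nat.add_zero]
      exact ih f

/-- The mean of the bridged trials: `Σ_{i<n} h(nth_C i) = Σ_{k ∈ range K, k ∈ C} h k`, `n = Nat.count (· ∈ C) K`. [this work] -/
theorem sum_nth_eq_sum_filter (h : ℕ → ℝ) (C : Finset ℕ) : ∀ K : ℕ,
    ∑ i ∈ range (Nat.count (· ∈ C) K), h (Nat.nth (· ∈ C) i) = ∑ k ∈ (range K).filter (fun k => k ∈ C), h k := by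
  intro K
  induction K with
  | zero => simp
  | succ K ih =>
    rw [Nat.count_succ, Finset.range_add_one, Finset.filter_insert]
    by_cases hKC : K ∈ C
    · rw [if_pos hKC, if_pos hKC, Finset.sum_range_succ, Nat.nth_count hKC, ih,
        Finset.sum_insert (by simp)]
      ring
    · rw [if_neg hKC, if_neg hKC, Nat.add_zero, ih]

/-! ## Independence of the counts in disjoint index sets -/

/-- **Product form.**  For disjoint finite `C`, `D` and all test functions `f`, `g`:
`Σ_Q hairW K h Q·f(#(Q∩C))·g(#(Q∩D)) = (Σ_Q hairW K h Q·f(#(Q∩C)))·(Σ_Q hairW K h Q·g(#(Q∩D)))`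
(the open counts in `C` and in `D` are independent). [this work] -/
theorem sum_hairW_count_mul_count (h : ℕ → ℝ) {C D : Finset ℕ} (hCD : Disjoint C D) : ∀ K : ℕ, ∀ f g : ℕ → ℝ,
    ∑ Q ∈ (range K).powerset, hairW K h Q * (f (Q ∩ C).card * g (Q ∩ D).card) =
      (∑ Q ∈ (range K).powerset, hairW K h Q * f (Q ∩ C).card) *
        (∑ Q ∈ (range K).powerset, hairW K h Q * g (Q ∩ D).card) := by
  intro K
  induction K with
  | zero => intro f g; simp [hairW]
  | succ K ih =>
    intro f g
    rw [sum_hairW_succ K h (fun Q => f (Q ∩ C).card * g (Q ∩ D).card), sum_hairW_count_succ K h C f,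
      sum_hairW_count_succ K h D g]
    by_cases hKC : K ∈ C
    · have hKD : K ∉ D := fun hd => Finset.disjoint_left.1 hCD hKC hd
      rw [if_pos hKC, if_neg hKD]
      have e : ∀ Q ∈ (range K).powerset,
          hairW K h Q * ((1 - h K) * (f (Q ∩ C).card * g (Q ∩ D).card) +
            h K * (f (insert K Q ∩ C).card * g (insert K Q ∩ D).card)) =
          (1 - h K) * (hairW K h Q * (f (Q ∩ C).card * g (Q ∩ D).card)) +
            h K * (hairW K h Q * (f ((Q ∩ C).card + 1) * g (Q ∩ D).card)) := by
        intro Q hQ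
        rw [Finset.mem_powerset] at hQ
        have hKQ : K ∉ Q ∩ C := fun hm => Finset.notMem_range_self (hQ (Finset.mem_inter.1 hm).1)
        rw [Finset.insert_inter_of_mem hKC, Finset.card_insert_of_notMem hKQ, Finset.insert_inter_of_notMem hKD]
        ring
      rw [Finset.sum_congr rfl e, Finset.sum_add_distrib, ← Finset.mul_sum, ← Finset.mul_sum, ih f g,
        ih (fun b => f (b + 1)) g]
      ring
    · rw [if_neg hKC]
      by_cases hKD : K ∈ D
      · rw [if_pos hKD]
        have e : ∀ Q ∈ (range K).powerset,
            hairW K h Q * ((1 - h K) * (f (Q ∩ C).card * g (Q ∩ D).card) +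
              h K * (f (insert K Q ∩ C).card * g (insert K Q ∩ D).card)) =
            (1 - h K) * (hairW K h Q * (f (Q ∩ C).card * g (Q ∩ D).card)) +
              h K * (hairW K h Q * (f (Q ∩ C).card * g ((Q ∩ D).card + 1))) := by
          intro Q hQ
          rw [Finset.mem_powerset] at hQ
          have hKQ : K ∉ Q ∩ D := fun hm => Finset.notMem_range_self (hQ (Finset.mem_inter.1 hm).1)
          rw [Finset.insert_inter_of_notMem hKC, Finset.insert_inter_of_mem hKD, Finset.card_insert_of_notMem hKQ]
          ring
        rw [Finset.sum_congr rfl e, Finset.sum_add_distrib, ← Finset.mul_sum, ← Finset.mul_sum, ih f g,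
          ih f (fun b => g (b + 1))]
        ring
      · rw [if_neg hKD]
        have e : ∀ Q ∈ (range K).powerset,
            hairW K h Q * ((1 - h K) * (f (Q ∩ C).card * g (Q ∩ D).card) +
              h K * (f (insert K Q ∩ C).card * g (insert K Q ∩ D).card)) =
            hairW K h Q * (f (Q ∩ C).card * g (Q ∩ D).card) := by
          intro Q _
          rw [Finset.insert_inter_of_notMem hKC, Finset.insert_inter_of_notMem hKD]
          ring
        rw [Finset.sum_congr rfl e, ih f g]

/-! ## Consequences for `hairV` -/

/-- **`hairV` as a `PB` tail**: `hairV K h j C = 1 − Σ_{i<j+1} PB[h ∘ nth_C, n] i` (`n = Nat.count (· ∈ C) K`). [this work] -/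
theorem hairV_eq_one_sub_cdf (h : ℕ → ℝ) (j : ℕ) (C : Finset ℕ) :
    hairV K h j C = 1 - ∑ i ∈ range (j + 1), PB[(fun i => h (Nat.nth (· ∈ C) i)), Nat.count (· ∈ C) K] i := by
  set n := Nat.count (· ∈ C) K with hn
  set q : ℕ → ℝ := fun i => h (Nat.nth (· ∈ C) i) with hq
  have hb := sum_hairW_count_eq_PB h C K (fun b => if j + 1 ≤ b then (1 : ℝ) else 0)
  unfold hairV
  rw [hb]
  -- `Σ_{b ≤ n} PB b · 𝟙[j+1 ≤ b] = 1 − Σ_{b<j+1} PB b`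
  have htot := Quant.CountDP.PB_sum_eq_one q n
  rcases Nat.lt_or_ge n (j + 1) with hnj | hnj
  · -- all mass below `j+1`
    have h1 : ∑ b ∈ range (n + 1), PB[q, n] b * (if j + 1 ≤ b then (1 : ℝ) else 0) = 0 :=
      Finset.sum_eq_zero fun b hb => by rw [Finset.mem_range] at hb; rw [if_neg (by omega), mul_zero]
    have h2 : ∑ i ∈ range (j + 1), PB[q, n] i = 1 := by
      rw [← Finset.sum_range_add_sum_Ico (fun i => PB[q, n] i) (show n + 1 ≤ j + 1 by omega), htot]
      have : ∑ i ∈ Finset.Ico (n + 1) (j + 1), PB[q, n] i = 0 :=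
        Finset.sum_eq_zero fun i hi => Quant.CountDP.PB_eq_zero_of_lt q n i (by rw [Finset.mem_Ico] at hi; omega)
      rw [this, add_zero]
    rw [h1, h2]; ring
  · rw [← Finset.sum_range_add_sum_Ico (fun i => PB[q, n] i) (show j + 1 ≤ n + 1 by omega)] at htot
    rw [← Finset.sum_range_add_sum_Ico _ (show j + 1 ≤ n + 1 by omega)]
    have h1 : ∑ b ∈ range (j + 1), PB[q, n] b * (if j + 1 ≤ b then (1 : ℝ) else 0) = 0 :=
      Finset.sum_eq_zero fun b hb => by rw [Finset.mem_range] at hb; rw [if_neg (by omega), mul_zero]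
    have h2 : ∑ b ∈ Finset.Ico (j + 1) (n + 1), PB[q, n] b * (if j + 1 ≤ b then (1 : ℝ) else 0) =
        ∑ b ∈ Finset.Ico (j + 1) (n + 1), PB[q, n] b :=
      Finset.sum_congr rfl fun b hb => by rw [Finset.mem_Ico] at hb; rw [if_pos hb.1, mul_one]
    rw [h1, h2]
    linarith

/-- **Union bound for the gap**: `Σ_Q hairW K h Q·𝟙[1 ≤ #(Q∩D)] ≤ Σ_{k ∈ range K, k ∈ D} h k` for `h ≥ 0` on `range K`
(the probability that some hair of `D` is open is at most the expected number of open hairs of `D`). [this work] -/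
theorem sum_hairW_pos_count_le {h : ℕ → ℝ} (hh : ∀ k, k < K → 0 ≤ h k ∧ h k ≤ 1) (D : Finset ℕ) :
    ∑ Q ∈ (range K).powerset, hairW K h Q * (if 1 ≤ (Q ∩ D).card then (1 : ℝ) else 0) ≤
      ∑ k ∈ (range K).filter (fun k => k ∈ D), h k := by
  -- `𝟙[1 ≤ #(Q∩D)] ≤ #(Q∩D) = Σ_{k ∈ D ∩ range K} 𝟙[k ∈ Q]`, and `Σ_Q hairW·𝟙[k ∈ Q] = h k`
  have hind : ∀ Q ∈ (range K).powerset, hairW K h Q * (if 1 ≤ (Q ∩ D).card then (1 : ℝ) else 0) ≤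
      hairW K h Q * ∑ k ∈ (range K).filter (fun k => k ∈ D), (if k ∈ Q then (1 : ℝ) else 0) := by
    intro Q hQ
    rw [Finset.mem_powerset] at hQ
    refine mul_le_mul_of_nonneg_left ?_ (hairW_nonneg hh Q)
    have e : ∑ k ∈ (range K).filter (fun k => k ∈ D), (if k ∈ Q then (1 : ℝ) else 0) = ((Q ∩ D).card : ℝ) := by
      rw [Finset.sum_ite, Finset.sum_const_zero, add_zero, Finset.sum_const, nsmul_eq_mul, mul_one]
      congr 2
      ext k
      simp only [Finset.mem_filter, Finset.mem_range, Finset.mem_inter]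
      exact ⟨fun ⟨⟨_, hkD⟩, hkQ⟩ => ⟨hkQ, hkD⟩, fun ⟨hkQ, hkD⟩ => ⟨⟨Finset.mem_range.1 (hQ hkQ), hkD⟩, hkQ⟩⟩
    rw [e]
    split_ifs with h1
    · exact_mod_cast h1
    · exact Nat.cast_nonneg _
  refine (Finset.sum_le_sum hind).trans ?_
  simp_rw [Finset.mul_sum]
  rw [Finset.sum_comm]
  refine Finset.sum_le_sum fun k hk => ?_
  rw [Finset.mem_filter, Finset.mem_range] at hk
  -- `Σ_Q hairW·𝟙[k ∈ Q] = h k`: the bridge with `C = {k}` and `f = id`... directly: marginal of one hair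
  have hb := sum_hairW_count_eq_PB h {k} K (fun b => (b : ℝ))
  have hcount : Nat.count (· ∈ ({k} : Finset ℕ)) K = 1 := by
    rw [Nat.count_eq_card_filter_range]
    have : (range K).filter (fun x => x ∈ ({k} : Finset ℕ)) = {k} := by
      ext x
      simp only [Finset.mem_filter, Finset.mem_range, Finset.mem_singleton]
      exact ⟨fun ⟨_, e⟩ => e, fun e => ⟨e ▸ hk.1, e⟩⟩
    rw [this, Finset.card_singleton]
  have hnth : Nat.nth (· ∈ ({k} : Finset ℕ)) 0 = k := by
    have := Nat.nth_count (p := (· ∈ ({k} : Finset ℕ))) (n := k) (Finset.mem_singleton_self k)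
    have hc0 : Nat.count (· ∈ ({k} : Finset ℕ)) k = 0 := by
      rw [Nat.count_eq_card_filter_range]
      have : (range k).filter (fun x => x ∈ ({k} : Finset ℕ)) = ∅ := by
        ext x
        simp only [Finset.mem_filter, Finset.mem_range, Finset.mem_singleton, Finset.notMem_empty, iff_false]
        omega
      rw [this, Finset.card_empty]
    rwa [hc0] at this
  have e1 : ∀ Q ∈ (range K).powerset, hairW K h Q * (if k ∈ Q then (1 : ℝ) else 0) = hairW K h Q * ((Q ∩ {k}).card : ℝ) := by
    intro Q _
    congr 1
    by_cases hkQ : k ∈ Q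
    · rw [if_pos hkQ, Finset.inter_singleton_of_mem hkQ, Finset.card_singleton]; norm_num
    · rw [if_neg hkQ, Finset.inter_singleton_of_notMem hkQ, Finset.card_empty]; norm_num
  rw [Finset.sum_congr rfl e1, hb, hcount]
  -- `Σ_{b<2} PB[q,1] b · b = q 0 = h k`
  set q : ℕ → ℝ := fun i => h (Nat.nth (· ∈ ({k} : Finset ℕ)) i) with hq
  have e0 : PB[q, 1] 0 = 1 - q 0 := by
    have := Quant.CountDP.PB_succ_zero q 0
    rwa [Nat.zero_add, Quant.CountDP.PB_zero_zero, mul_one] at this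
  have e2 : PB[q, 1] 1 = q 0 := by
    have := Quant.CountDP.PB_succ_succ q 0 0
    rwa [Nat.zero_add, Quant.CountDP.PB_zero_zero, Quant.CountDP.PB_zero_succ, mul_one, mul_zero, add_zero] at this
  have hq0 : q 0 = h k := by rw [hq]; simp only [hnth]
  rw [Finset.sum_range_succ, Finset.sum_range_succ, Finset.sum_range_zero, e0, e2, hq0]
  push_cast
  linarith

/-- **The gap bound of LEMMA L.**  For a finite `C` with gap `D = range K \ C`, `h ∈ [0,1]` on `range K` and any layer `j`:
`hairV K h j (range K) − hairV K h j C ≤ (1 − hairV K h j C) · min 1 (Σ_{k ∈ D} h k)` — having at least `j+1` open hairs in all but at most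
`j` in `C` forces an open hair in the gap, and the two counts are independent. [this work] -/
theorem hairV_univ_sub_hairV_le {h : ℕ → ℝ} (hh : ∀ k, k < K → 0 ≤ h k ∧ h k ≤ 1) (j : ℕ) (C : Finset ℕ) :
    hairV K h j (range K) - hairV K h j C ≤ (1 - hairV K h j C) * min 1 (∑ k ∈ range K \ C, h k) := by
  set D := range K \ C with hD
  have hCD : Disjoint C D := by rw [hD]; exact Finset.disjoint_sdiff
  -- pointwise: `𝟙[j+1 ≤ #Q] − 𝟙[j+1 ≤ #(Q∩C)] ≤ 𝟙[#(Q∩C) ≤ j]·𝟙[1 ≤ #(Q∩D)]` for `Q ⊆ range K`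
  have hpt : ∀ Q ∈ (range K).powerset,
      hairW K h Q * (if j + 1 ≤ (Q ∩ range K).card then (1 : ℝ) else 0) - hairW K h Q * (if j + 1 ≤ (Q ∩ C).card then (1 : ℝ) else 0) ≤
        hairW K h Q * ((if (Q ∩ C).card < j + 1 then (1 : ℝ) else 0) * (if 1 ≤ (Q ∩ D).card then (1 : ℝ) else 0)) := by
    intro Q hQ
    rw [Finset.mem_powerset] at hQ
    rw [← mul_sub]
    refine mul_le_mul_of_nonneg_left ?_ (hairW_nonneg hh Q)
    have hQeq : Q ∩ range K = Q := Finset.inter_eq_left.2 hQ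
    have hsplit : Q.card = (Q ∩ C).card + (Q ∩ D).card := by
      rw [← Finset.card_union_of_disjoint (Finset.disjoint_of_subset_left Finset.inter_subset_right
        (Finset.disjoint_of_subset_right Finset.inter_subset_right hCD))]
      congr 1
      ext k
      simp only [Finset.mem_union, Finset.mem_inter, hD, Finset.mem_sdiff, Finset.mem_range]
      constructor
      · intro hk
        by_cases hkC : k ∈ C
        · exact Or.inl ⟨hk, hkC⟩
        · exact Or.inr ⟨hk, Finset.mem_range.1 (hQ hk), hkC⟩
      · rintro (⟨hk, _⟩ | ⟨hk, _⟩) <;> exact hk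
    rw [hQeq, hsplit]
    by_cases hB : j + 1 ≤ (Q ∩ C).card
    · have hA : j + 1 ≤ (Q ∩ C).card + (Q ∩ D).card := by omega
      have hC' : ¬ ((Q ∩ C).card < j + 1) := by omega
      simp only [if_pos hA, if_pos hB, if_neg hC']
      split_ifs <;> norm_num
    · have hC' : (Q ∩ C).card < j + 1 := by omega
      simp only [if_neg hB, if_pos hC']
      by_cases hA : j + 1 ≤ (Q ∩ C).card + (Q ∩ D).card
      · have hD' : 1 ≤ (Q ∩ D).card := by omega
        simp only [if_pos hA, if_pos hD']
        norm_num
      · simp only [if_neg hA]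
        split_ifs <;> norm_num
  have hsum := Finset.sum_le_sum hpt
  have hprod := sum_hairW_count_mul_count h hCD K (fun b => if b < j + 1 then (1 : ℝ) else 0)
    (fun b => if 1 ≤ b then (1 : ℝ) else 0)
  rw [Finset.sum_sub_distrib, hprod] at hsum
  -- identify the pieces
  have hVuniv : hairV K h j (range K) = ∑ Q ∈ (range K).powerset, hairW K h Q * (if j + 1 ≤ (Q ∩ range K).card then (1 : ℝ) else 0) := rfl
  have hVC : hairV K h j C = ∑ Q ∈ (range K).powerset, hairW K h Q * (if j + 1 ≤ (Q ∩ C).card then (1 : ℝ) else 0) := rfl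
  have hcomp : ∑ Q ∈ (range K).powerset, hairW K h Q * (if (Q ∩ C).card < j + 1 then (1 : ℝ) else 0) = 1 - hairV K h j C := by
    have hadd : ∑ Q ∈ (range K).powerset, hairW K h Q * (if (Q ∩ C).card < j + 1 then (1 : ℝ) else 0) + hairV K h j C = 1 := by
      rw [hVC, ← Finset.sum_add_distrib]
      calc ∑ Q ∈ (range K).powerset, (hairW K h Q * (if (Q ∩ C).card < j + 1 then (1 : ℝ) else 0) +
              hairW K h Q * (if j + 1 ≤ (Q ∩ C).card then (1 : ℝ) else 0))
          = ∑ Q ∈ (range K).powerset, hairW K h Q :=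
            Finset.sum_congr rfl fun Q _ => by
              by_cases h1 : j + 1 ≤ (Q ∩ C).card
              · have h2 : ¬ ((Q ∩ C).card < j + 1) := by omega
                rw [if_neg h2, if_pos h1]; ring
              · have h2 : (Q ∩ C).card < j + 1 := by omega
                rw [if_pos h2, if_neg h1]; ring
        _ = 1 := sum_hairW_eq_one h
    linarith
  rw [← hVuniv, ← hVC, hcomp] at hsum
  refine hsum.trans (mul_le_mul_of_nonneg_left ?_ ?_)
  · refine le_min ?_ ?_
    · -- `P(N_D ≥ 1) ≤ 1`
      calc ∑ Q ∈ (range K).powerset, hairW K h Q * (if 1 ≤ (Q ∩ D).card then (1 : ℝ) else 0)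
          ≤ ∑ Q ∈ (range K).powerset, hairW K h Q :=
            Finset.sum_le_sum fun Q _ => by
              have := hairW_nonneg hh Q
              split_ifs <;> nlinarith
        _ = 1 := sum_hairW_eq_one h
    · -- union bound
      have := sum_hairW_pos_count_le hh D
      have e : (range K).filter (fun k => k ∈ D) = D := by
        ext k
        simp only [Finset.mem_filter, hD, Finset.mem_sdiff, Finset.mem_range]
        tauto
      rwa [e] at this
  · -- `0 ≤ 1 − hairV`
    rw [← hcomp]
    exact Finset.sum_nonneg fun Q _ => mul_nonneg (hairW_nonneg hh Q) (by split_ifs <;> norm_num)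

end Summit.CriticalPhenomena.PercolationContinuityZ3.Theorems.HairyCycle

end
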